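import Summits.CriticalPhenomena.PercolationContinuityZ3.Theorems.PercNearOneGluingNoHeavyPcintNawFreeMemAlong
import HarnessLib

/-!
# PCINT lane, reduction B2d on the dangerous-set automaton — payment slots and their records

Cell `prim-pcint` (PAPER-2 track (iii)), seat `prim-pcint-1` (gen 6); support file (`--supports stmt-CriticalPhenomena-4575`).
Does NOT build on p205010.  Memo: run/shared/lean/prim/pcint/REDUCTIONS.md §B2d.

In the world of a sibling order `o`, the INCLUDED sites of step `t` are the inspected sites that are unconditional, or
conditional (the corner site) with the corner at node `t + 1 - kt` bad for `o` (`fincl`).  The payment SLOTS are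
`(t, prepay?, w)` (`fslots`); the RECORD of a slot is (absolute site, paid incidence index): `t + 3 - kt` for a prepay slot and
`t + 1 - kt` for a self slot (`frec`).  Proved: records are incidences of `o`-forced sites (`frec_mem_cincSet`) and the record
map is INJECTIVE on the slots (`frec_injOn`: a self slot two steps after a prepay slot at the same site is excluded by the
certainty clause of `fself`), and `#fslots = Σ_t Σ_{w included} fnpay` (`card_fslots_eq`).
-/

noncomputable section

namespace Summit.CriticalPhenomena.PercolationContinuityZ3.Theorems.Pcint

open Finset Literature.Probability.Percolation Literature.Probability.LatticeModels
open Literature.Probability.FitznerVanDerHofstad2017 (wordPos_wordInit)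

variable {{d : ℕ}}

section Records

open Classical

variable (a₀ : Fin d × Bool) (τ kt : ℕ) {n : ℕ} (γ : Fin n → Fin d × Bool)

/-- The sites INCLUDED in the world of `o` at step `t`: inspected, and unconditional or (conditional and the corner at node
`t + 1 - kt` is bad for `o`). [folklore] -/
def fincl (o : Orders d n) (t : ℕ) (ht : t < n) : Finset (Site d) :=
  (fsites kt (danger τ (pre a₀ γ t)) (γ ⟨t, ht⟩)).filter fun w =>
    funcond (danger τ (pre a₀ γ t)) (γ ⟨t, ht⟩) w = true ∨
      (fcond kt (danger τ (pre a₀ γ t)) (γ ⟨t, ht⟩) w = true ∧ IsBad o γ (t + 1 - kt))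

/-- The payment SLOTS of the world of `o`: `(t, true, w)` for a prepay at the included site `w` of step `t`, `(t, false, w)` for a
self payment. [folklore] -/
def fslots (o : Orders d n) : Finset (ℕ × Bool × Site d) :=
  (range n).attach.biUnion fun t =>
    (((fincl a₀ τ kt γ o t.1 (mem_range.1 t.2)).filter fun w =>
        fprepay kt (danger τ (pre a₀ γ t.1)) (γ ⟨t.1, mem_range.1 t.2⟩) w = true).image fun w => (t.1, true, w)) ∪
    (((fincl a₀ τ kt γ o t.1 (mem_range.1 t.2)).filter fun w =>
        fself τ kt (danger τ (pre a₀ γ t.1)) (γ ⟨t.1, mem_range.1 t.2⟩) w = true).image fun w => (t.1, false, w))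

/-- The RECORD of a slot: (absolute site, paid incidence index) — `t + 3 - kt` for a prepay slot, `t + 1 - kt` for a self slot.
[folklore] -/
def frec (x : ℕ × Bool × Site d) : Site d × ℕ := (fabs γ x.1 x.2.2, if x.2.1 then x.1 + 3 - kt else x.1 + 1 - kt)

variable {τ kt γ}

/-- Membership in `fincl`. [folklore] -/
theorem mem_fincl {o : Orders d n} {t : ℕ} {ht : t < n} {w : Site d} :
    w ∈ fincl a₀ τ kt γ o t ht ↔ w ∈ fsites kt (danger τ (pre a₀ γ t)) (γ ⟨t, ht⟩) ∧
      (funcond (danger τ (pre a₀ γ t)) (γ ⟨t, ht⟩) w = true ∨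
        (fcond kt (danger τ (pre a₀ γ t)) (γ ⟨t, ht⟩) w = true ∧ IsBad o γ (t + 1 - kt))) := mem_filter

/-- Membership in the slot set. [folklore] -/
theorem mem_fslots {o : Orders d n} {t : ℕ} {β : Bool} {w : Site d} :
    (t, β, w) ∈ fslots a₀ τ kt γ o ↔ ∃ ht : t < n, w ∈ fincl a₀ τ kt γ o t ht ∧
      (if β then fprepay kt (danger τ (pre a₀ γ t)) (γ ⟨t, ht⟩) w = true
        else fself τ kt (danger τ (pre a₀ γ t)) (γ ⟨t, ht⟩) w = true) := by
  simp only [fslots, mem_biUnion, mem_attach, true_and, Subtype.exists, mem_range, mem_union, mem_image, mem_filter,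
    Prod.mk.injEq]
  constructor
  · rintro ⟨t', ht', (⟨w', ⟨hw', hp⟩, rfl, hβ, rfl⟩ | ⟨w', ⟨hw', hp⟩, rfl, hβ, rfl⟩)⟩
    · exact ⟨ht', hw', by rw [← hβ]; simpa using hp⟩
    · exact ⟨ht', hw', by rw [← hβ]; simpa using hp⟩
  · rintro ⟨ht, hw, hβ⟩
    refine ⟨t, ht, ?_⟩
    cases β
    · exact Or.inr ⟨w, ⟨hw, by simpa using hβ⟩, rfl, rfl, rfl⟩
    · exact Or.inl ⟨w, ⟨hw, by simpa using hβ⟩, rfl, rfl, rfl⟩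

/-- A slot carries a payment: `fnpay ≠ 0` at its site. [folklore] -/
theorem fnpay_ne_zero_of_mem_fslots {o : Orders d n} {t : ℕ} {β : Bool} {w : Site d}
    (hx : (t, β, w) ∈ fslots a₀ τ kt γ o) : ∃ ht : t < n, fnpay τ kt (danger τ (pre a₀ γ t)) (γ ⟨t, ht⟩) w ≠ 0 := by
  obtain ⟨ht, -, hβ⟩ := (mem_fslots a₀).1 hx
  refine ⟨ht, ?_⟩
  unfold fnpay
  cases β
  · simp only [Bool.false_eq_true, if_false] at hβ; simp [hβ]
  · simp only [if_true] at hβ; simp [hβ]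

/-- **Included sites with a payment are forced in the world of `o`.** [folklore] -/
theorem fabs_mem_forcedSites (hτ : 2 ≤ τ) (hkt : 2 * kt ≤ τ) (hkt2 : 2 ≤ kt) (hs : IsSAW γ) (hch : chordEdges γ = ∅)
    {o : Orders d n} {t : ℕ} {ht : t < n} {w : Site d} (hw : w ∈ fincl a₀ τ kt γ o t ht)
    (hpay : fnpay τ kt (danger τ (pre a₀ γ t)) (γ ⟨t, ht⟩) w ≠ 0) : fabs γ t w ∈ forcedSites o γ := by
  obtain ⟨hws, hcase⟩ := (mem_fincl a₀).1 hw
  rcases hcase with hunc | ⟨hcond, hbad⟩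
  · exact forced_of_funcond a₀ hτ hkt hch o ht hws hpay hunc
  · exact forced_of_fcond a₀ hτ hkt hkt2 hs hch o ht hws hpay ((fcond_iff kt).1 hcond).2 hbad

/-- **Records are incidences of forced sites.** [folklore] -/
theorem frec_mem_cincSet (hτ : 2 ≤ τ) (hkt : 2 * kt ≤ τ) (hkt2 : 2 ≤ kt) (hs : IsSAW γ) (hch : chordEdges γ = ∅)
    {o : Orders d n} {x : ℕ × Bool × Site d} (hx : x ∈ fslots a₀ τ kt γ o) : frec kt γ x ∈ cincSet γ o := by
  rcases x with ⟨t, β, w⟩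
  obtain ⟨ht, hw, hβ⟩ := (mem_fslots a₀).1 hx
  obtain ⟨ht2, hpay⟩ := fnpay_ne_zero_of_mem_fslots a₀ hx
  have hforced := fabs_mem_forcedSites a₀ hτ hkt hkt2 hs hch hw hpay
  simp only [frec]
  rw [cincSet, mem_biUnion]
  refine ⟨fabs γ t w, hforced, mem_image.2 ⟨_, ?_, rfl⟩⟩
  obtain ⟨hws, -⟩ := (mem_fincl a₀).1 hw
  cases β
  · -- self: the pseudo-tip `v_{t+1-kt}` is an incidence
    simp only [Bool.false_eq_true, if_false]
    obtain ⟨hk, hadj, -⟩ := fsites_spec a₀ ht hws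
    exact mem_filter.2 ⟨mem_range.2 (by omega), hadj⟩
  · -- prepay: the incidence of age `kt - 2`
    simp only [if_true] at hβ ⊢
    obtain ⟨q, hq, hq2⟩ := (fprepay_iff kt).1 hβ
    have := sub_mem_incTimes_of_mem_finc a₀ ht hq
    rw [show t + 1 - q.2 = t + 3 - kt by omega] at this
    exact this

/-- A prepay slot at step `t` and a self slot at step `t'` with the same site never pay the same index: `t' = t + 2` would
make the pseudo-tip of step `t` an incidence of age `kt + 2` at step `t'`, visible by the certainty clause of `fself`.
[folklore] -/
theorem prepay_ne_self (hτ : 2 ≤ τ) {t t' : ℕ} (ht : t < n) (ht' : t' < n) {w w' : Site d}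
    (hws : w ∈ fsites kt (danger τ (pre a₀ γ t)) (γ ⟨t, ht⟩))
    (hself : fself τ kt (danger τ (pre a₀ γ t')) (γ ⟨t', ht'⟩) w' = true) (hW : fabs γ t w = fabs γ t' w') :
    t + 3 - kt ≠ t' + 1 - kt := by
  intro heq
  obtain ⟨hk, hadjP, -⟩ := fsites_spec a₀ ht hws
  obtain ⟨hguard, hno, -⟩ := (fself_iff τ kt).1 hself
  have hA : kt + 2 ≤ t' + 1 := by omega
  have e1 : t' + 1 - (kt + 2) = t + 1 - kt := by omega
  have hadj' : (zdGraph d).Adj (wordPos γ (t' + 1 - (kt + 2))) (fabs γ t' w') := by rw [e1, ← hW]; exact hadjP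
  have hmem := mem_finc_of_adj a₀ hτ ht' hA (by omega) hadj'
  exact hno _ hmem rfl

/-- Slots of equal kind with equal records come from the same step. [folklore] -/
theorem step_eq_of_frec_eq {t t' : ℕ} (hk : kt ≤ t + 1) (hk' : kt ≤ t' + 1) {β : Bool}
    (hidx : (if β then t + 3 - kt else t + 1 - kt) = (if β then t' + 3 - kt else t' + 1 - kt)) : t = t' := by
  cases β
  · simp only [Bool.false_eq_true, if_false] at hidx; omega
  · simp only [if_true] at hidx; omega

/-- Slots of different kinds never have equal records (core of the injectivity). [folklore] -/
theorem frec_kind_eq (hτ : 2 ≤ τ) {t t' : ℕ} (ht : t < n) (ht' : t' < n) {β β' : Bool} {w w' : Site d}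
    (hws : w ∈ fsites kt (danger τ (pre a₀ γ t)) (γ ⟨t, ht⟩)) (hws' : w' ∈ fsites kt (danger τ (pre a₀ γ t')) (γ ⟨t', ht'⟩))
    (hβ : if β then fprepay kt (danger τ (pre a₀ γ t)) (γ ⟨t, ht⟩) w = true
      else fself τ kt (danger τ (pre a₀ γ t)) (γ ⟨t, ht⟩) w = true)
    (hβ' : if β' then fprepay kt (danger τ (pre a₀ γ t')) (γ ⟨t', ht'⟩) w' = true
      else fself τ kt (danger τ (pre a₀ γ t')) (γ ⟨t', ht'⟩) w' = true)
    (hW : fabs γ t w = fabs γ t' w')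
    (hidx : (if β then t + 3 - kt else t + 1 - kt) = (if β' then t' + 3 - kt else t' + 1 - kt)) : β = β' := by
  cases β <;> cases β'
  · rfl
  · simp only [Bool.false_eq_true, if_false, if_true] at hidx hβ hβ'
    exact absurd hidx.symm (prepay_ne_self a₀ hτ ht' ht hws' hβ hW.symm)
  · simp only [Bool.false_eq_true, if_false, if_true] at hidx hβ hβ'
    exact absurd hidx (prepay_ne_self a₀ hτ ht ht' hws hβ' hW)
  · rfl

set_option maxHeartbeats 800000 in
/-- Core of the injectivity: two slots with the same record have the same step, kind and site. [folklore] -/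
theorem frec_inj_core (hτ : 2 ≤ τ) {o : Orders d n} {t t' : ℕ} {β β' : Bool} {w w' : Site d}
    (hx : (t, β, w) ∈ fslots a₀ τ kt γ o) (hx' : (t', β', w') ∈ fslots a₀ τ kt γ o) (hW : fabs γ t w = fabs γ t' w')
    (hidx : (if β then t + 3 - kt else t + 1 - kt) = (if β' then t' + 3 - kt else t' + 1 - kt)) :
    t = t' ∧ β = β' ∧ w = w' := by
  obtain ⟨ht, hw, hβ⟩ := (mem_fslots a₀).1 hx
  obtain ⟨ht', hw', hβ'⟩ := (mem_fslots a₀).1 hx'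
  have hws := (Finset.mem_filter.1 hw).1
  have hws' := (Finset.mem_filter.1 hw').1
  have hb : β = β' := frec_kind_eq a₀ hτ ht ht' hws hws' hβ hβ' hW hidx
  subst hb
  have htt : t = t' := step_eq_of_frec_eq (fsites_spec a₀ ht hws).1 (fsites_spec a₀ ht' hws').1 hidx
  refine ⟨htt, rfl, ?_⟩
  rw [htt] at hW
  exact add_right_cancel hW

set_option maxHeartbeats 800000 in
/-- **Injectivity of the records** on the slots of one world. [folklore] -/
theorem frec_injOn (hτ : 2 ≤ τ) {o : Orders d n} :
    Set.InjOn (frec kt γ) (fslots a₀ τ kt γ o : Set (ℕ × Bool × Site d)) := by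
  rintro ⟨t, β, w⟩ hx ⟨t', β', w'⟩ hx' heq
  simp only [frec, Prod.mk.injEq] at heq
  obtain ⟨h1, h2, h3⟩ := frec_inj_core a₀ hτ (mem_coe.1 hx) (mem_coe.1 hx') heq.1 heq.2
  exact Prod.ext h1 (Prod.ext h2 h3)

/-- The payments of the included sites of a step, split by kind. [folklore] -/
theorem sum_fnpay_fincl (o : Orders d n) (t : ℕ) (ht : t < n) :
    ∑ w ∈ fincl a₀ τ kt γ o t ht, fnpay τ kt (danger τ (pre a₀ γ t)) (γ ⟨t, ht⟩) w =
      ((fincl a₀ τ kt γ o t ht).filter fun w => fprepay kt (danger τ (pre a₀ γ t)) (γ ⟨t, ht⟩) w = true).card +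
        ((fincl a₀ τ kt γ o t ht).filter fun w => fself τ kt (danger τ (pre a₀ γ t)) (γ ⟨t, ht⟩) w = true).card := by
  rw [card_eq_sum_ones, card_eq_sum_ones, sum_filter, sum_filter, ← sum_add_distrib]
  refine sum_congr rfl fun w _ => ?_
  unfold fnpay
  split_ifs <;> rfl

/-- **The number of slots is the total payment** `Σ_t Σ_{w included} fnpay`. [folklore] -/
theorem card_fslots_eq (o : Orders d n) :
    (fslots a₀ τ kt γ o).card = ∑ t ∈ (range n).attach,
      ∑ w ∈ fincl a₀ τ kt γ o t.1 (mem_range.1 t.2), fnpay τ kt (danger τ (pre a₀ γ t.1)) (γ ⟨t.1, mem_range.1 t.2⟩) w := by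
  rw [fslots, card_biUnion]
  · refine sum_congr rfl fun t _ => ?_
    rw [card_union_of_disjoint, card_image_of_injective _ (fun w w' h => by simpa using h),
      card_image_of_injective _ (fun w w' h => by simpa using h), sum_fnpay_fincl]
    rw [Finset.disjoint_left]
    rintro x hx hx'
    obtain ⟨w, -, rfl⟩ := mem_image.1 hx
    obtain ⟨w', -, h⟩ := mem_image.1 hx'
    simpa using congrArg (fun y => y.2.1) h
  · intro t _ t' _ htt
    simp only [Function.onFun]
    rw [Finset.disjoint_left]
    rintro x hx hx'
    have h1 : x.1 = t.1 := by
      rcases mem_union.1 hx with h | h <;> { obtain ⟨w, -, rfl⟩ := mem_image.1 h; rfl }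
    have h2 : x.1 = t'.1 := by
      rcases mem_union.1 hx' with h | h <;> { obtain ⟨w, -, rfl⟩ := mem_image.1 h; rfl }
    exact htt (Subtype.ext (h1.symm.trans h2))

/-- The slots whose record is at a given site inject into its incidence times: their number is at most `#incTimes`.
[folklore] -/
theorem card_fiber_le_incTimes (hτ : 2 ≤ τ) (hkt : 2 * kt ≤ τ) (hkt2 : 2 ≤ kt) (hs : IsSAW γ) (hch : chordEdges γ = ∅)
    (o : Orders d n) (W : Site d) :
    ((fslots a₀ τ kt γ o).filter fun x => (frec kt γ x).1 = W).card ≤ (incTimes γ W).card := by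
  set T := (fslots a₀ τ kt γ o).filter fun x => (frec kt γ x).1 = W
  have hinj : Set.InjOn (frec kt γ) (T : Set (ℕ × Bool × Site d)) :=
    (frec_injOn a₀ hτ).mono (by intro x hx; exact (mem_filter.1 hx).1)
  rw [← card_image_of_injOn hinj]
  refine card_le_card_of_injOn Prod.snd (fun y hy => ?_) ?_
  · obtain ⟨x, hx, rfl⟩ := mem_image.1 hy
    obtain ⟨hxs, hxW⟩ := mem_filter.1 hx
    have hmem := frec_mem_cincSet a₀ hτ hkt hkt2 hs hch hxs
    rw [cincSet, mem_biUnion] at hmem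
    obtain ⟨w, -, hw⟩ := hmem
    obtain ⟨i, hi, hiw⟩ := mem_image.1 hw
    have h1 : w = W := by rw [← hxW, ← hiw]
    have h2 : (frec kt γ x).2 = i := by rw [← hiw]
    rw [mem_coe, ← h1, h2]; exact hi
  · intro y hy y' hy' h
    obtain ⟨x, hx, rfl⟩ := mem_image.1 (mem_coe.1 hy)
    obtain ⟨x', hx', rfl⟩ := mem_image.1 (mem_coe.1 hy')
    have e1 := (mem_filter.1 hx).2
    have e2 := (mem_filter.1 hx').2
    exact Prod.ext (e1.trans e2.symm) h

end Records

end Summit.CriticalPhenomena.PercolationContinuityZ3.Theorems.Pcint
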